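import Summits.AtomisticToContinuum.Crystallization.Theses.GscTwinLoopSurgery
import Literature.MathematicalPhysics.StatisticalMechanics.LocalLimitOfGroundStates
import Literature.MathematicalPhysics.StatisticalMechanics.HardCoreGSC

/-!
# Line `birth` — birth-certificate skeleton (BC3) for the crux `HcpPerfectWindows`
(stmt-AtomisticToContinuum-14085, route `GscTwinLoopSurgery`, rank 5)

THE CRUX (weak window-Liouville rigidity of near-hcp Lennard-Jones ground state configurations):
for `(a,h) ∈ B′ = {191/200 ≤ a ≤ 197/200, (81/100)a ≤ h ≤ (329/400)a}` and `X ∈ 𝔏` (local limit of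
translated LJ ground states) a hard-core GSC that is GLOBALLY two-way `1/1000`-matched with
`H := hcpStacking a h`, every scale `R` and tolerance `ε > 0` admit a ball `B(c,R)` on which `X` is
two-way `ε`-matched with a TRANSLATE `H + v`.

THE LINE (the route's own two-layer plan "HcpBoxStability → CaccioppoliWindows → HcpPerfectWindows",
made into four registered stubs and one PROVED glue lemma; `u := φ − id` is the displacement of `X` over `H`):

* `stub_onePerSite` (M, provable now) — ONE PARTICLE PER SITE: a local limit of LJ ground states that
  is globally two-way `1/1000`-matched with `H` is a BIJECTIVE `1/1000`-perturbation of `H`: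
  `∃ φ, Set.BijOn φ H X ∧ ∀ p ∈ H, dist (φ p) p ≤ 1/1000`.  (Ground states are `1/3`-separated —
  the `δ = 1/3` of the discharge `LennardJonesMinimalDistance_holds`, re-exposed — and separation
  passes to local limits, `IsLocalLimitOfGroundStates.le_dist`; `H` is `min a h ≥ 0.77`-separated,
  `le_dist_of_mem_barlowStacking`; so the `1/1000`-matching is a bijection.  Template: the LANDED
  `ExcessDecayLiouville.stub_onePerSite`, `Theorems/ExcessDecayLiouvilleHcpLiouvilleOnePerSite.lean`.)
* `stub_hcpBoxCoercivity` (L, a certified computation; = the route's foreseen child `HcpBoxStability`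
  at the crux's own amplitude `1/1000`) — BOX COERCIVITY of the LJ second variation around
  `hcpStacking a h`, `(a,h) ∈ B′`: for every site displacement `w` with `‖w‖ ≤ 1/1000` and every
  finitely supported test field `u`, `κ Σ_{|p−q| ≤ 6a/5} ‖u_p − u_q‖² ≤ ½ Σ_{p ≠ q} K(e_pq)[u_p−u_q]`,
  `e_pq = (p + w_p) − (q + w_q)`, `K(e)[d] = V″(|e|)(ê·d)² + (V′(|e|)/|e|)(|d|² − (ê·d)²)`.  It is the
  diagonal-cell, exact-inner-shift, amplitude-`1/1000` slice of the sibling vocabulary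
  `ExcessDecayLiouville.BoxCoercive (1/1000) κ` (`Theorems/ExcessDecayLiouvilleHcpLiouvilleDefs.lean`;
  floats: `+0.30` at amplitude `1/80`, NEGATIVE only at `1/40` with inner mis-shift — `HcpLiouville/Lines/Sketch.md`).
* `stub_caccioppoli` (XL, THE HARDEST; = the route's `CaccioppoliWindows` minus the window extraction)
  — MEAN FLATNESS OF A NEAR-HCP GSC: under box coercivity at `(a,h)`, a hard-core GSC `X = φ(H) ∈ 𝔏`
  with `|φ − id| ≤ 1/1000` has nearest-neighbour strain energy `Σ_{p,q ∈ H ∩ B(0,L), |p−q| ≤ 6a/5}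
  ‖u_p − u_q‖² ≤ C·L²` for all `L ≥ 1` (GSC ⇒ force balance; `H` itself is force-balanced at every
  `(a,h)` by the site symmetry `-6m2`; frozen-secant linear equation for `u` + box coercivity ⇒
  Caccioppoli; template: the LANDED `ExcessDecayLiouville.stub_levelOneGrowth` (`GrowthBound ≤ C·R`)
  and `LinearCaccioppoli.lean` of crux 9332, there at amplitude `1/40` under `SecantCoercive`).
* `stub_flatWindows` (M, provable now; functions on the sites of `H` only, no `X`) — PIGEONHOLE + GRAPH
  POINCARÉ: if the strain energy of `φ − id` in `B(0,L)` is `O(L²)`, then for every `R` and `ε > 0` some ball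
  `B(c,R)` is `ε`-flat, `‖(φ p − p) − (φ q − q)‖ ≤ ε` for all sites `p, q` in it (among the `≍ (L/R)³`
  disjoint `R`-balls of `B(0,L)` one carries strain energy `≤ C R³/L → 0`; the bond graph of `H` joins two
  sites of a ball by `O(R/a)` bonds inside its `3`-neighbourhood; template: `PathBound.lean` of 9332).
* `windows_of_flat` (PROVED glue) — a bijective `1/1000`-perturbation that is `ε`-flat on `B(c,R+2)` is two-way
  `ε`-matched on `B(c,R)` with the translate `H + (φ p₀ − p₀)`.
* `composition` — the kernel-checked composition `<stub sigs> → (crux unfolded)` (logic +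
  `windows_of_flat`; axioms `propext`, `Classical.choice`, `Quot.sound`), and `HcpPerfectWindows_of :
  HcpPerfectWindows` — the crux concluded BY NAME, the four declared stubs discharged inside the proof
  (`sorry` only in `stub_*`).

Disproof used: none exists for this crux (`ledger crux ls stmt-AtomisticToContinuum-14085`: no
workfiles, 2026-08-17); negatives index (20 entries) has no statement about hcp windows / Liouville;
refuter crux-attack 2026-08-15 (survives): the content is `0 < ε < 1/1000`, `R → ∞` — honoured: the
`ε ≥ 1/1000` slice is the case `v = 0` of the PROVED glue `windows_of_flat`, all difficulty sits
in `stub_caccioppoli` + `stub_hcpBoxCoercivity`.  Sibling negative knowledge honoured: the certified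
NEGATIVE Bloch pencil of `HcpLiouville/Lines/Sketch.dead.md` lives at amplitude `1/40` with an inner
mis-shift `0.0248`; this line never leaves amplitude `1/1000` around the EXACT hcp shift.

Conventions: stub signatures are ONE LINE, FULLY QUALIFIED, no `let` (they must survive textual
restatement in a `Theorems/`-side `--supports` file); NO `open scoped Classical` — the `if … then … else 0`
summands use the canonical instances (`Real` order, `DecidableEq` of `EuclideanSpace`), and the four
signatures elaborate standalone over `import Mathlib` + `LocalLimitOfGroundStates` + `HardCoreGSC` +
`BarlowStacking` (checked, rc 0), so a prover restates them verbatim.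
-/

noncomputable section

namespace Summit.AtomisticToContinuum.Crystallization.Cruxes.HcpPerfectWindows.Birth

open scoped BigOperators InnerProductSpace
open Literature.MathematicalPhysics.StatisticalMechanics
open Summit.AtomisticToContinuum.Crystallization.Theses.GscTwinLoopSurgery

local notation "E3" => EuclideanSpace ℝ (Fin 3)

/-! ## The crux in named form -/

/-- The crux is, by definitional unfolding (`isLocalLimitOfGroundStates_iff`, `isHardCoreGSC_iff` are
`Iff.rfl`), the statement over the Literature predicates `IsLocalLimitOfGroundStates` (`X ∈ 𝔏`) and
`IsHardCoreGSC`. -/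
theorem hcpPerfectWindows_iff :
    HcpPerfectWindows ↔
      ∀ (a h : ℝ) (X : Set E3), (191 / 200 ≤ a ∧ a ≤ 197 / 200 ∧ 81 / 100 * a ≤ h ∧ h ≤ 329 / 400 * a) →
        IsLocalLimitOfGroundStates lennardJones 3 X → IsHardCoreGSC lennardJones X →
          ((∀ p ∈ hcpStacking a h, ∃ q ∈ X, dist q p ≤ 1 / 1000) ∧
            (∀ q ∈ X, ∃ p ∈ hcpStacking a h, dist q p ≤ 1 / 1000)) →
          ∀ R ε : ℝ, 0 < ε → ∃ c v : E3,
            (∀ p ∈ ((fun p => p + v) '' hcpStacking a h), dist p c ≤ R → ∃ q ∈ X, dist q p ≤ ε) ∧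
              (∀ q ∈ X, dist q c ≤ R → ∃ p ∈ ((fun p => p + v) '' hcpStacking a h), dist q p ≤ ε) :=
  Iff.rfl

/-! ## Registered stubs (sorries live ONLY here) -/

/-- **STUB 1 — one particle per site** (size M, provable now). A local limit of translated LJ ground
states that is globally two-way `1/1000`-matched with `hcpStacking a h`, `(a,h) ∈ B′`, is a bijective
`1/1000`-perturbation of it. Proof: LJ ground states are `1/3`-separated (the argument of
`LennardJonesMinimalDistance_holds` with its `δ = 1/3` exposed), separation passes to local limits
(`IsLocalLimitOfGroundStates.le_dist`), `hcpStacking a h` is `min a h`-separated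
(`le_dist_of_mem_barlowStacking`), and `2/1000 < min (1/3) (min a h)`; `φ p :=` the unique point of `X`
within `1/1000` of `p` (cf. the landed `ExcessDecayLiouville.stub_onePerSite`, `onePerSite_atMostOne`). -/
theorem stub_onePerSite : ∀ (a h : ℝ) (X : Set (EuclideanSpace ℝ (Fin 3))), (191 / 200 ≤ a ∧ a ≤ 197 / 200 ∧ 81 / 100 * a ≤ h ∧ h ≤ 329 / 400 * a) → Literature.MathematicalPhysics.StatisticalMechanics.IsLocalLimitOfGroundStates Literature.MathematicalPhysics.StatisticalMechanics.lennardJones 3 X → ((∀ p ∈ Literature.MathematicalPhysics.StatisticalMechanics.hcpStacking a h, ∃ q ∈ X, dist q p ≤ 1 / 1000) ∧ (∀ q ∈ X, ∃ p ∈ Literature.MathematicalPhysics.StatisticalMechanics.hcpStacking a h, dist q p ≤ 1 / 1000)) → ∃ φ : EuclideanSpace ℝ (Fin 3) → EuclideanSpace ℝ (Fin 3), Set.BijOn φ (Literature.MathematicalPhysics.StatisticalMechanics.hcpStacking a h) X ∧ ∀ p ∈ Literature.MathematicalPhysics.StatisticalMechanics.hcpStacking a h, dist (φ p) p ≤ 1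 / 1000 := by
  sorry

/-- **STUB 2 — box coercivity of LJ-hcp on `B′` at amplitude `1/1000`** (size L, a certified computation;
the route's foreseen child `HcpBoxStability`). For `(a,h) ∈ B′`, every displacement `w` of the sites of
`hcpStacking a h` with `‖w‖ ≤ 1/1000` and every finitely supported test field `u`, the LJ second variation
AT THE DISPLACED CONFIGURATION dominates `κ` times the nearest-neighbour strain norm (inter-sublattice
bonds included, so optical modes are controlled). Discharge: the diagonal cells `A = diag(a,a,h/√(2/3))`
with `t = (0, w_a + h e₃)` are admissible data of the sibling vocabulary (`‖A − 0.97‖ ≤ 0.0226 < 1/40`,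
exact inner shift), so `∃ κ₁ > 0, ExcessDecayLiouville.BoxCoercive (1/1000) κ₁` implies it after the
dictionary `Sites₀ t A = hcpStacking a h`; floats give `+0.30` already at amplitude `1/80`. Bloch reduction
to a `6 × 6` Hermitian family, interval arithmetic, explicit `r⁻⁸` tail bounds, acoustic asymptotics. -/
theorem stub_hcpBoxCoercivity : ∀ a h : ℝ, (191 / 200 ≤ a ∧ a ≤ 197 / 200 ∧ 81 / 100 * a ≤ h ∧ h ≤ 329 / 400 * a) → ∃ κ : ℝ, 0 < κ ∧ ∀ w : EuclideanSpace ℝ (Fin 3) → EuclideanSpace ℝ (Fin 3), (∀ s ∈ Literature.MathematicalPhysics.StatisticalMechanics.hcpStacking a h, ‖w s‖ ≤ 1 / 1000) → ∀ u : EuclideanSpace ℝ (Fin 3) → EuclideanSpace ℝ (Fin 3), (Function.support u).Finite → Function.support u ⊆ Literature.MathematicalPhysics.StatisticalMechanics.hcpStacking a h → κ * (∑' p : ↥(Literature.MathematicalPhysics.StatisticalMechanics.hcpStacking a h), ∑' q : ↥(Literature.MathematicalPhysics.StatisticalMechanics.hcpStacking a h), if dist (p : EuclideanSpace ℝ (Fin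 3)) (q : EuclideanSpace ℝ (Fin 3)) ≤ 6 / 5 * a then ‖u p - u q‖ ^ 2 else 0) ≤ (∑' p : ↥(Literature.MathematicalPhysics.StatisticalMechanics.hcpStacking a h), ∑' q : ↥(Literature.MathematicalPhysics.StatisticalMechanics.hcpStacking a h), if (p : EuclideanSpace ℝ (Fin 3)) ≠ (q : EuclideanSpace ℝ (Fin 3)) then (deriv (deriv Literature.MathematicalPhysics.StatisticalMechanics.lennardJones) ‖((p : EuclideanSpace ℝ (Fin 3)) + w p) - ((q : EuclideanSpace ℝ (Fin 3)) + w q)‖ * (inner ℝ (((p : EuclideanSpace ℝ (Fin 3)) + w p) - ((q : EuclideanSpace ℝ (Fin 3)) + w q)) (u p - u q) / ‖((p : EuclideanSpace ℝ (Fin 3)) + w p) - ((q : EuclideanSpace ℝ (Fin 3)) + w q)‖) ^ 2 + deriv Literature.MathematicalPhysics.StatisticalMechanics.lennardJones ‖((p : EuclideanSpace ℝ (Fin 3)) + w p) - ((q : EuclideanSpace ℝ (Fin 3)) + w q)‖ / ‖((p : EuclideanSpace ℝ (Fin 3)) + w p) - ((q : EuclideanSpace ℝ (Fin 3)) + w q)‖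 * (‖u p - u q‖ ^ 2 - (inner ℝ (((p : EuclideanSpace ℝ (Fin 3)) + w p) - ((q : EuclideanSpace ℝ (Fin 3)) + w q)) (u p - u q) / ‖((p : EuclideanSpace ℝ (Fin 3)) + w p) - ((q : EuclideanSpace ℝ (Fin 3)) + w q)‖) ^ 2)) else 0) / 2 := by
  sorry

/-- **STUB 3 — Caccioppoli / mean flatness of a near-hcp GSC** (size XL, THE HARDEST STUB). Under the
box coercivity of STUB 2 at `(a,h) ∈ B′`, a hard-core GSC `X ∈ 𝔏` that is a bijective
`1/1000`-perturbation `φ(H)` of `H = hcpStacking a h` has nearest-neighbour strain energy `O(L²)` in the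
balls `‖·‖ ≤ L`. Mechanism: (i) GSC ⇒ force balance of `X` (one-point moves, Fermat; the infinite-volume
analogue of the proved `ExcessDecayLiouville.ForceBalance`); (ii) `H` is force-balanced at every `(a,h)`
(site symmetry `-6m2`: basal mirror + 3-fold axis pair off the force sum); (iii) the difference of the two
force identities is an exact frozen-secant LINEAR equation for `u = φ − id` (template `LinearEq.lean` of
crux 9332), whose coefficients are `K` evaluated inside the `1/1000`-box, hence coercive by STUB 2 along
the whole chord; (iv) test with a cut-off of `u − u(c)` on `B(0,L+3)`: Caccioppoli gives the strain energy
in `B(0,L)` `≤ C·(L² + L)·‖u‖∞²/κ` (template: the LANDED `stub_levelOneGrowth`, `GrowthBound ≤ C·R`, and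
`LinearCaccioppoli.lean`). Alternative (minimality instead of the equation): compare with the competitor
"perfect `H` on `B(0,L−1)`, `X` outside", excess `O(L²)`. Why it might fail: far-field tails of the
secant operator (`r⁻⁸`, summable) must be book-kept at infinite volume; `X ∈ 𝔏` is carried but unused. -/
theorem stub_caccioppoli : ∀ (a h : ℝ) (X : Set (EuclideanSpace ℝ (Fin 3))) (φ : EuclideanSpace ℝ (Fin 3) → EuclideanSpace ℝ (Fin 3)), (191 / 200 ≤ a ∧ a ≤ 197 / 200 ∧ 81 / 100 * a ≤ h ∧ h ≤ 329 / 400 * a) → (∃ κ : ℝ, 0 < κ ∧ ∀ w : EuclideanSpace ℝ (Fin 3) → EuclideanSpace ℝ (Fin 3), (∀ s ∈ Literature.MathematicalPhysics.StatisticalMechanics.hcpStacking a h, ‖w s‖ ≤ 1 / 1000) → ∀ u : EuclideanSpace ℝ (Fin 3) → EuclideanSpace ℝ (Fin 3), (Function.support u).Finite → Function.support u ⊆ Literature.MathematicalPhysics.StatisticalMechanics.hcpStacking a h → κ * (∑' p : ↥(Literature.MathematicalPhysics.StatisticalMechanics.hcpStacking a h), ∑' q : ↥(Literature.MathematicalPhysics.StatisticalMechanics.hcpStacking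 a h), if dist (p : EuclideanSpace ℝ (Fin 3)) (q : EuclideanSpace ℝ (Fin 3)) ≤ 6 / 5 * a then ‖u p - u q‖ ^ 2 else 0) ≤ (∑' p : ↥(Literature.MathematicalPhysics.StatisticalMechanics.hcpStacking a h), ∑' q : ↥(Literature.MathematicalPhysics.StatisticalMechanics.hcpStacking a h), if (p : EuclideanSpace ℝ (Fin 3)) ≠ (q : EuclideanSpace ℝ (Fin 3)) then (deriv (deriv Literature.MathematicalPhysics.StatisticalMechanics.lennardJones) ‖((p : EuclideanSpace ℝ (Fin 3)) + w p) - ((q : EuclideanSpace ℝ (Fin 3)) + w q)‖ * (inner ℝ (((p : EuclideanSpace ℝ (Fin 3)) + w p) - ((q : EuclideanSpace ℝ (Fin 3)) + w q)) (u p - u q) / ‖((p : EuclideanSpace ℝ (Fin 3)) + w p) - ((q : EuclideanSpace ℝ (Fin 3)) + w q)‖) ^ 2 + deriv Literature.MathematicalPhysics.StatisticalMechanics.lennardJones ‖((p : EuclideanSpace ℝ (Fin 3)) + w p) - ((q : EuclideanSpace ℝ (Fin 3)) + w q)‖ / ‖((p : EuclideanSpace ℝ (Fin 3)) + w p) - ((q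 : EuclideanSpace ℝ (Fin 3)) + w q)‖ * (‖u p - u q‖ ^ 2 - (inner ℝ (((p : EuclideanSpace ℝ (Fin 3)) + w p) - ((q : EuclideanSpace ℝ (Fin 3)) + w q)) (u p - u q) / ‖((p : EuclideanSpace ℝ (Fin 3)) + w p) - ((q : EuclideanSpace ℝ (Fin 3)) + w q)‖) ^ 2)) else 0) / 2) → Literature.MathematicalPhysics.StatisticalMechanics.IsLocalLimitOfGroundStates Literature.MathematicalPhysics.StatisticalMechanics.lennardJones 3 X → Literature.MathematicalPhysics.StatisticalMechanics.IsHardCoreGSC Literature.MathematicalPhysics.StatisticalMechanics.lennardJones X → Set.BijOn φ (Literature.MathematicalPhysics.StatisticalMechanics.hcpStacking a h) X → (∀ p ∈ Literature.MathematicalPhysics.StatisticalMechanics.hcpStacking a h, dist (φ p) p ≤ 1 / 1000) → ∃ C : ℝ, ∀ L : ℝ, 1 ≤ L → (∑' p : ↥(Literature.MathematicalPhysics.StatisticalMechanics.hcpStacking a h), ∑' q : ↥(Literature.MathematicalPhysics.StatisticalMechanics.hcpStacking a h), if ‖(p : EuclideanSpace ℝ (Fin 3))‖ ≤ L ∧ ‖(q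 : EuclideanSpace ℝ (Fin 3))‖ ≤ L ∧ dist (p : EuclideanSpace ℝ (Fin 3)) (q : EuclideanSpace ℝ (Fin 3)) ≤ 6 / 5 * a then ‖(φ p - (p : EuclideanSpace ℝ (Fin 3))) - (φ q - (q : EuclideanSpace ℝ (Fin 3)))‖ ^ 2 else 0) ≤ C * L ^ 2 := by
  sorry

/-- **STUB 4 — flat windows from mean flatness** (size M, provable now; a statement about functions on the
sites of `hcpStacking a h` only — no `X`, no energetics). If the nearest-neighbour strain energy of `φ − id`
in the balls `‖·‖ ≤ L` grows at most like `L²` (any sub-cubic growth would do), then for every `R` and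
`ε > 0` some ball `B(c,R)` is `ε`-FLAT: `‖(φ p − p) − (φ q − q)‖ ≤ ε` for all sites `p, q` in it. Proof:
PIGEONHOLE — for `R' = max R 0 + 3` pack `N ≍ (L/R')³` disjoint balls `B(c_k, R')` into `B(0,L)`
(`finite_barlowStacking_inter_closedBall` for the bookkeeping); the bond sums over them add up to `≤ C L²`,
so one is `≤ C' R'³/L ≤ η²` for `L` large, and every single bond difference in it is `≤ η`; GRAPH POINCARÉ —
two sites of `H ∩ B(c,R)` are joined by `≤ M(R,a)` bonds (`|p−q| ≤ 6a/5`) inside `B(c,R')` (hcp navigation: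
the twelve bond directions are `35.3°`-dense on the sphere, so a greedy bond path stays within `2a < 2` of
the segment), whence `‖δu‖ ≤ M η ≤ ε`. Template: `PathBound.lean` / `flatDiff_pathBound_of_growthBound`
of crux 9332. The window bookkeeping (translate `v := φ p₀ − p₀`, two-way matching) is PROVED below
(`windows_of_flat`), not stubbed. -/
theorem stub_flatWindows : ∀ (a h : ℝ) (φ : EuclideanSpace ℝ (Fin 3) → EuclideanSpace ℝ (Fin 3)), (191 / 200 ≤ a ∧ a ≤ 197 / 200 ∧ 81 / 100 * a ≤ h ∧ h ≤ 329 / 400 * a) → (∃ C : ℝ, ∀ L : ℝ, 1 ≤ L → (∑' p : ↥(Literature.MathematicalPhysics.StatisticalMechanics.hcpStacking a h), ∑' q : ↥(Literature.MathematicalPhysics.StatisticalMechanics.hcpStacking a h), if ‖(p : EuclideanSpace ℝ (Fin 3))‖ ≤ L ∧ ‖(q : EuclideanSpace ℝ (Fin 3))‖ ≤ L ∧ dist (p : EuclideanSpace ℝ (Fin 3)) (q : EuclideanSpace ℝ (Fin 3)) ≤ 6 / 5 * a then ‖(φ p - (p : EuclideanSpace ℝ (Fin 3))) - (φ q - (q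 : EuclideanSpace ℝ (Fin 3)))‖ ^ 2 else 0) ≤ C * L ^ 2) → ∀ R ε : ℝ, 0 < ε → ∃ c : EuclideanSpace ℝ (Fin 3), ∀ p ∈ Literature.MathematicalPhysics.StatisticalMechanics.hcpStacking a h, ∀ q ∈ Literature.MathematicalPhysics.StatisticalMechanics.hcpStacking a h, dist p c ≤ R → dist q c ≤ R → ‖(φ p - p) - (φ q - q)‖ ≤ ε := by
  sorry

/-! ## Proved glue: a flat ball of a bijective `1/1000`-perturbation is a perfect window -/

/-- **Window bookkeeping** (proved). If `X = φ(H)` bijectively with `dist (φ p) p ≤ 1/1000` on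
`H = hcpStacking a h`, and `φ − id` is `ε`-flat on the sites of the ball `B(c, R + 2)`, then on `B(c,R)` the
configuration `X` is two-way `ε`-matched with the translate `H + v`, `v := φ p₀ − p₀` for any site `p₀` of
the larger ball (and vacuously, with `v = 0`, if that ball has no site): clause 1 uses `‖v‖ ≤ 1/1000`,
clause 2 uses the surjectivity of `φ`. This is the `ε < 1/1000` content of the crux's conclusion; the slice
`ε ≥ 1/1000` (refuter's `windows_of_le_tolerance`) is the same computation with `v = 0`. -/
theorem windows_of_flat {a h : ℝ} {X : Set E3} {φ : E3 → E3}
    (hφ : Set.BijOn φ (hcpStacking a h) X) (hclose : ∀ p ∈ hcpStacking a h, dist (φ p) p ≤ 1 / 1000)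
    {R ε : ℝ} {c : E3}
    (hflat : ∀ p ∈ hcpStacking a h, ∀ q ∈ hcpStacking a h, dist p c ≤ R + 2 → dist q c ≤ R + 2 →
      ‖(φ p - p) - (φ q - q)‖ ≤ ε) :
    ∃ c v : E3,
      (∀ p ∈ ((fun p => p + v) '' hcpStacking a h), dist p c ≤ R → ∃ q ∈ X, dist q p ≤ ε) ∧
        (∀ q ∈ X, dist q c ≤ R → ∃ p ∈ ((fun p => p + v) '' hcpStacking a h), dist q p ≤ ε) := by
  by_cases hne : ∃ p₀ ∈ hcpStacking a h, dist p₀ c ≤ R + 2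
  · obtain ⟨p₀, hp₀, hp₀c⟩ := hne
    -- the translate: `v := φ p₀ − p₀`, `‖v‖ ≤ 1/1000`
    have hv : ‖φ p₀ - p₀‖ ≤ 1 / 1000 := by rw [← dist_eq_norm]; exact hclose p₀ hp₀
    have hkey : ∀ p ∈ hcpStacking a h, dist p c ≤ R + 2 →
        dist (φ p) (p + (φ p₀ - p₀)) ≤ ε := by
      intro p hp hpc
      have h1 := hflat p hp p₀ hp₀ hpc hp₀c
      rw [dist_eq_norm]
      have h2 : φ p - (p + (φ p₀ - p₀)) = (φ p - p) - (φ p₀ - p₀) := by abel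
      rw [h2]
      exact h1
    refine ⟨c, φ p₀ - p₀, ?_, ?_⟩
    · -- clause 1: a translated site within `R` of `c` is a site within `R + 1/1000 ≤ R + 2` of `c`
      rintro _ ⟨p, hp, rfl⟩ hpc
      refine ⟨φ p, hφ.mapsTo hp, ?_⟩
      have h3 : dist p c ≤ dist p (p + (φ p₀ - p₀)) + dist (p + (φ p₀ - p₀)) c := dist_triangle _ _ _
      have h4 : dist p (p + (φ p₀ - p₀)) = ‖φ p₀ - p₀‖ := by
        rw [dist_comm, dist_eq_norm, add_sub_cancel_left]
      exact hkey p hp (by linarith)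
    · -- clause 2: a point of `X` within `R` of `c` is `φ p` for a site `p` within `R + 1/1000` of `c`
      intro q hq hqc
      obtain ⟨p, hp, rfl⟩ := hφ.surjOn hq
      refine ⟨p + (φ p₀ - p₀), ⟨p, hp, rfl⟩, ?_⟩
      have h3 : dist p c ≤ dist p (φ p) + dist (φ p) c := dist_triangle _ _ _
      have h4 : dist p (φ p) ≤ 1 / 1000 := by rw [dist_comm]; exact hclose p hp
      exact hkey p hp (by linarith)
  · -- no site within `R + 2` of `c`: both clauses are vacuous with `v = 0`
    push Not at hne
    refine ⟨c, 0, ?_, ?_⟩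
    · rintro _ ⟨p, hp, rfl⟩ hpc
      have h1 := hne p hp
      simp only [add_zero] at hpc
      linarith
    · intro q hq hqc
      obtain ⟨p, hp, rfl⟩ := hφ.surjOn hq
      have h1 := hne p hp
      have h3 : dist p c ≤ dist p (φ p) + dist (φ p) c := dist_triangle _ _ _
      have h4 : dist p (φ p) ≤ 1 / 1000 := by rw [dist_comm]; exact hclose p hp
      linarith

/-! ## Composition -/

/-- **The composition** (`<stub₁-sig> → … → <stub₄-sig> → (the crux, unfolded)`; the hypotheses are the
registered signatures verbatim up to `open`/notation, as `HcpPerfectWindows_of` checks by feeding the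
declared stubs): one particle per site gives the displacement field `φ`, box coercivity feeds the
Caccioppoli bound, mean flatness yields an `ε`-flat ball of radius `R + 2`, and the proved glue
`windows_of_flat` turns it into the two-way `ε`-window against a translate of `hcpStacking a h`.
(Stated with the crux UNFOLDED, `hcpPerfectWindows_iff`, so that exactly one theorem of this file —
`HcpPerfectWindows_of` — concludes the route decl by name, with no hypotheses.) -/
theorem composition
    (hA : ∀ (a h : ℝ) (X : Set (E3)), (191 / 200 ≤ a ∧ a ≤ 197 / 200 ∧ 81 / 100 * a ≤ h ∧ h ≤ 329 / 400 * a) → IsLocalLimitOfGroundStates lennardJones 3 X → ((∀ p ∈ hcpStacking a h, ∃ q ∈ X, dist q p ≤ 1 / 1000) ∧ (∀ q ∈ X, ∃ p ∈ hcpStacking a h, dist q p ≤ 1 / 1000)) → ∃ φ : E3 → E3, Set.BijOn φ (hcpStacking a h) X ∧ ∀ p ∈ hcpStacking a h, dist (φ p) p ≤ 1 / 1000)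
    (hS : ∀ a h : ℝ, (191 / 200 ≤ a ∧ a ≤ 197 / 200 ∧ 81 / 100 * a ≤ h ∧ h ≤ 329 / 400 * a) → ∃ κ : ℝ, 0 < κ ∧ ∀ w : E3 → E3, (∀ s ∈ hcpStacking a h, ‖w s‖ ≤ 1 / 1000) → ∀ u : E3 → E3, (Function.support u).Finite → Function.support u ⊆ hcpStacking a h → κ * (∑' p : ↥(hcpStacking a h), ∑' q : ↥(hcpStacking a h), if dist (p : E3) (q : E3) ≤ 6 / 5 * a then ‖u p - u q‖ ^ 2 else 0) ≤ (∑' p : ↥(hcpStacking a h), ∑' q : ↥(hcpStacking a h), if (p : E3) ≠ (q : E3) then (deriv (deriv lennardJones) ‖((p : E3) + w p) - ((q : E3) + w q)‖ * (inner ℝ (((p : E3) + w p) - ((q : E3) + w q)) (u p - u q) / ‖((p : E3) + w p) - ((q : E3) + w q)‖) ^ 2 + deriv lennardJones ‖((p : E3) + w p) - ((q : E3) + w q)‖ / ‖((p : E3) + w p) - ((q : E3) + w q)‖ * (‖u p - u q‖ ^ 2 - (inner ℝ (((p : E3) + w p) - ((q : E3) + w q)) (u p - u q) / ‖((p : E3)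 + w p) - ((q : E3) + w q)‖) ^ 2)) else 0) / 2)
    (hB : ∀ (a h : ℝ) (X : Set (E3)) (φ : E3 → E3), (191 / 200 ≤ a ∧ a ≤ 197 / 200 ∧ 81 / 100 * a ≤ h ∧ h ≤ 329 / 400 * a) → (∃ κ : ℝ, 0 < κ ∧ ∀ w : E3 → E3, (∀ s ∈ hcpStacking a h, ‖w s‖ ≤ 1 / 1000) → ∀ u : E3 → E3, (Function.support u).Finite → Function.support u ⊆ hcpStacking a h → κ * (∑' p : ↥(hcpStacking a h), ∑' q : ↥(hcpStacking a h), if dist (p : E3) (q : E3) ≤ 6 / 5 * a then ‖u p - u q‖ ^ 2 else 0) ≤ (∑' p : ↥(hcpStacking a h), ∑' q : ↥(hcpStacking a h), if (p : E3) ≠ (q : E3) then (deriv (deriv lennardJones) ‖((p : E3) + w p) - ((q : E3) + w q)‖ * (inner ℝ (((p : E3) + w p) - ((q : E3) + w q)) (u p - u q) / ‖((p : E3) + w p) - ((q : E3) + w q)‖) ^ 2 + deriv lennardJones ‖((p : E3) + w p) - ((q : E3) + w q)‖ / ‖((p : E3) + w p) - ((q : E3) + w q)‖ * (‖u p - u q‖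 ^ 2 - (inner ℝ (((p : E3) + w p) - ((q : E3) + w q)) (u p - u q) / ‖((p : E3) + w p) - ((q : E3) + w q)‖) ^ 2)) else 0) / 2) → IsLocalLimitOfGroundStates lennardJones 3 X → IsHardCoreGSC lennardJones X → Set.BijOn φ (hcpStacking a h) X → (∀ p ∈ hcpStacking a h, dist (φ p) p ≤ 1 / 1000) → ∃ C : ℝ, ∀ L : ℝ, 1 ≤ L → (∑' p : ↥(hcpStacking a h), ∑' q : ↥(hcpStacking a h), if ‖(p : E3)‖ ≤ L ∧ ‖(q : E3)‖ ≤ L ∧ dist (p : E3) (q : E3) ≤ 6 / 5 * a then ‖(φ p - (p : E3)) - (φ q - (q : E3))‖ ^ 2 else 0) ≤ C * L ^ 2)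
    (hC : ∀ (a h : ℝ) (φ : E3 → E3), (191 / 200 ≤ a ∧ a ≤ 197 / 200 ∧ 81 / 100 * a ≤ h ∧ h ≤ 329 / 400 * a) → (∃ C : ℝ, ∀ L : ℝ, 1 ≤ L → (∑' p : ↥(hcpStacking a h), ∑' q : ↥(hcpStacking a h), if ‖(p : E3)‖ ≤ L ∧ ‖(q : E3)‖ ≤ L ∧ dist (p : E3) (q : E3) ≤ 6 / 5 * a then ‖(φ p - (p : E3)) - (φ q - (q : E3))‖ ^ 2 else 0) ≤ C * L ^ 2) → ∀ R ε : ℝ, 0 < ε → ∃ c : E3, ∀ p ∈ hcpStacking a h, ∀ q ∈ hcpStacking a h, dist p c ≤ R → dist q c ≤ R → ‖(φ p - p) - (φ q - q)‖ ≤ ε) :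
    ∀ (a h : ℝ) (X : Set E3), (191 / 200 ≤ a ∧ a ≤ 197 / 200 ∧ 81 / 100 * a ≤ h ∧ h ≤ 329 / 400 * a) →
      IsLocalLimitOfGroundStates lennardJones 3 X → IsHardCoreGSC lennardJones X →
        ((∀ p ∈ hcpStacking a h, ∃ q ∈ X, dist q p ≤ 1 / 1000) ∧
          (∀ q ∈ X, ∃ p ∈ hcpStacking a h, dist q p ≤ 1 / 1000)) →
        ∀ R ε : ℝ, 0 < ε → ∃ c v : E3,
          (∀ p ∈ ((fun p => p + v) '' hcpStacking a h), dist p c ≤ R → ∃ q ∈ X, dist q p ≤ ε) ∧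
            (∀ q ∈ X, dist q c ≤ R → ∃ p ∈ ((fun p => p + v) '' hcpStacking a h), dist q p ≤ ε) := by
  intro a h X hbox hL hG hM R ε hε
  -- STUB 1: the displacement field `φ − id` of `X` over `hcpStacking a h`
  obtain ⟨φ, hφ, hclose⟩ := hA a h X hbox hL hM
  -- STUB 2 feeds STUB 3: mean flatness `Σ_{B(0,L)} ‖δu‖² ≤ C L²`
  obtain ⟨C, hCL⟩ := hB a h X φ hbox (hS a h hbox) hL hG hφ hclose
  -- STUB 4: pigeonhole + graph Poincaré give an `ε`-flat ball of radius `R + 2`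
  obtain ⟨c, hc⟩ := hC a h φ hbox ⟨C, hCL⟩ (R + 2) ε hε
  -- proved glue: the flat ball is an `ε`-perfect window against the translate `H + (φ p₀ − p₀)`
  exact windows_of_flat hφ hclose hc

/-- **The crux from the line, concluded BY NAME** (type literally the route decl
`GscTwinLoopSurgery.HcpPerfectWindows`; no hypotheses — the four declared stubs are discharged inside the
proof, `sorry` lives only in `stub_*`). -/
theorem HcpPerfectWindows_of : HcpPerfectWindows :=
  hcpPerfectWindows_iff.2
    (composition stub_onePerSite stub_hcpBoxCoercivity stub_caccioppoli stub_flatWindows)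

end Summit.AtomisticToContinuum.Crystallization.Cruxes.HcpPerfectWindows.Birth

end
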